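import Literature.NumberTheory.EllipticCurves.TwoDescentOneRootGalois
import Literature.GroupTheory.KleinFourCrossedHom
import HarnessLib

/-!
# Injectivity of `H¹(k, E[2]) → H¹(K, E[2]) → H¹(K, μ₂) ≅ Kˣ/Kˣ²` over the cubic `2`-division field
# (Cassels, *Lectures on Elliptic Curves*, §15: `μ : 𝔊/2𝔊 ↪ ℚ[Θ]*/ℚ[Θ]*²` lifted to all of `H¹(ℚ, E[2])`)

Sequel of `TwoDescentOneRootCharacter.lean` (the character `χ_θ : E[2] → μ₂` of ONE rational `2`-torsion point
and `H¹(χ_θ)`). Setting: an elliptic curve `E/k` (`char k = 0`) whose monic `2`-division cubic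
`x³ + (b₂/4)x² + (b₄/2)x + b₆/4` is IRREDUCIBLE over `k` (no `k`-rational `2`-torsion), an extension `K/k` of
degree `3` and a root `θ ∈ K` of the `2`-division cubic (so `K = k(θ)` is "the" cubic `2`-division field,
Cassels' `ℚ[Θ]`). The composite

  `Φ : H¹(k, E[2]) —res→ H¹(K, E_K[2]) —H¹(χ_θ)→ H¹(K, μ₂)`

(`oneRootDescentH1`; followed by Kummer theory `H¹(K, μ₂) ≃ Kˣ/Kˣ²` it is the cohomological form of
Cassels' map `P ↦ x(P) − θ`) is **INJECTIVE** (`oneRootDescentH1_injective`). Equivalently: the kernel of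
the general `2`-descent map on `H¹(k, E[2])` is trivial, so the `2`-Selmer group `Sel⁽²⁾(E/k) ⊂ H¹(k, E[2])`
EMBEDS into `Kˣ/Kˣ²` — the input that upgrades a `2`-descent rank certificate over the cubic field
(`#E(k)/2E(k) ≤ #{admissible classes}`) to a `2`-SELMER bound (`#Sel⁽²⁾(E/k) ≤ #{admissible classes}`, hence
`Ш(E/k)[2] = 0` when the count is `2^rank`).

Proof (`H¹(χ_θ)` alone is not injective on `H¹(K, E[2])`; the `Γ_k`-structure is used):
* (cocycles) a class `[φ]` killed by `Φ` has `φ(g) ∈ {O, T_θ}` for every `g` in the image `Γ_K ↪ Γ_k`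
  (`apply_eq_zero_or_eq_of_oneRootCharH1_eq_zero` of the prequel, read through the restriction cocycle);
* (Galois) that image is EXACTLY the stabiliser of the point `T_θ ∈ E[2](k̄)` (`smul_geomOneRootOverTorsion_eq_iff` of `TwoDescentOneRootGalois.lean`:
  `Γ_K` fixes the `K`-rational point; conversely an automorphism fixing `θ` fixes `k(θ) = K`, primitive
  element theorem `Field.primitive_element_iff_minpoly_natDegree_eq` with `minpoly_k(θ)` = the cubic), and
  `Γ_k` fixes no non-zero point of `E[2]` (`exists_smul_ne_of_irreducible`: Galois descent
  `fixedPoints_eq_range_map_holds` and irreducibility);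
* (group theory, `Literature.GroupTheory.KleinCocycle.exists_eq_smul_sub_of_apply_stabilizer` of
  `Literature/GroupTheory/KleinFourCrossedHom.lean`) a crossed homomorphism `φ : G → V` into
  a Klein four-group `V = {0, T, T₂, T₃}` on which `G` acts by automorphisms without non-zero fixed vector and
  with `φ(Stab_G T) ⊆ {0, T}` is PRINCIPAL: the image of `G` in `Aut V ≅ S₃` contains a `3`-cycle `s`
  (`exists_threeCycle`); correcting `φ` by the coboundary of the unique `P` with `s•P − P = φ(s)` one may assume
  `φ(s) = 0`; then for `h ∈ Stab T`, `φ(h) = φ(hs) ∈ {0,T} ∩ s^j•{0,T} = {0}` (`hs ∈ s^j · Stab T`, `j = 1, 2`),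
  and `G = ⋃ s^j · Stab T` gives `φ = 0`.

Everything is proved; no named fact, no `sorry`. Seat `bsd-line-spt-p1` (g28), milestone S2 of the
`2`-Selmer upgrade of the kernel general `2`-descent certificates (successors: the local conditions of Selmer
classes in `Kˣ/Kˣ²`, place by place, and the Selmer-soundness of the certificate checker).

## References

* [Cassels1991LecturesEllipticCurves] J. W. S. Cassels, *Lectures on Elliptic Curves*, LMSST 24, CUP 1991, §15
  (pp. 42–44: `μ`, Lemma 2 "the kernel of `μ` is `2𝔊`", footnote on irreducible `F`).
* [SilvermanAEC2009] J. H. Silverman, *The Arithmetic of Elliptic Curves*, 2nd ed., GTM 106 (2009), Thm. X.1.1,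
  Prop. X.1.4, Exercise 10.9, VIII.§1 (Galois descent).
* [SerreGaloisCohomology1997] J.-P. Serre, *Galois Cohomology*, Springer 1997, I.§2.2–2.4, I.§5.1, II.§1.1.
-/

noncomputable section

open scoped Classical

universe u

namespace WeierstrassCurve

open Literature Literature.NumberTheory.GaloisRepresentations Literature.NumberTheory.EllipticCurves Field
open WeierstrassCurve.Affine Polynomial Literature.GroupTheory

variable {k : Type u} [Field k] [CharZero k] (W : WeierstrassCurve k) [W.IsElliptic]
  {K : Type u} [Field K] [Algebra k K] [Algebra.IsAlgebraic k K] {θ : K}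

/-! ## The descent map on `H¹(k, E[2])` and its injectivity -/

variable (K) in
/-- **The cohomological one-root (Cassels) descent map** `Φ : H¹(k, E[2]) → H¹(K, μ₂)`: restriction to `K`
followed by `H¹(χ_θ)`. With Kummer theory `H¹(K, μ₂) ≃ Kˣ/Kˣ²` this is the extension to `H¹(k, E[2])` of Cassels'
`P ↦ x(P) − θ`. [cite: Cassels1991LecturesEllipticCurves, §15 (the map μ)] -/
def oneRootDescentH1 [CharZero K] [(W.baseChange K).IsElliptic] (hθ : (W.baseChange K).toAffine.IsTwoTorsionX θ) :
    galH1Torsion W 2 →+ H1Mu K 2 :=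
  ((W.baseChange K).oneRootCharH1 hθ).comp (resTorsion W K 2)

omit [CharZero k] [W.IsElliptic] [Algebra.IsAlgebraic k K] in
/-- Unfolding `oneRootDescentH1`. [cite: Cassels1991LecturesEllipticCurves, §15] -/
theorem oneRootDescentH1_apply [CharZero K] [(W.baseChange K).IsElliptic] (hθ : (W.baseChange K).toAffine.IsTwoTorsionX θ)
    (c : galH1Torsion W 2) :
    W.oneRootDescentH1 K hθ c = (W.baseChange K).oneRootCharH1 hθ (resTorsion W K 2 c) :=
  rfl

omit [CharZero k] [W.IsElliptic] [Algebra.IsAlgebraic k K] in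
/-- **Restriction on explicit cocycles**: `res [φ] = [ι ∘ φ ∘ resGal]`, `ι : E[2](k̄) → E_K[2](K̄)` the coefficient
map of the tree's restriction. [cite: SerreGaloisCohomology1997, I.§2.4] -/
theorem resTorsion_oneCocycleClass
    (φ : contOneCocycles (discreteTopRep (absoluteGaloisGroup k) (geomTorsion W 2))) :
    resTorsion W K 2 (oneCocycleClass _ φ) =
      oneCocycleClass _ (contOneCocycles.pullback (resGal (K := k) K)
        (resHomOfEquivariant (resGal (K := k) K) (torsionBaseChangeMap W K 2)
          (torsionBaseChangeMap_smul W K 2)) φ) :=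
  map_oneCocycleClass (X := discreteTopRep (absoluteGaloisGroup k) (geomTorsion W 2))
    (Y := discreteTopRep (absoluteGaloisGroup K) (geomTorsion (W.baseChange K) 2)) (resGal (K := k) K)
    (resHomOfEquivariant (resGal (K := k) K) (torsionBaseChangeMap W K 2) (torsionBaseChangeMap_smul W K 2)) φ

/-- **A cocycle killed by `Φ` takes values in `{O, T_θ}` on `galRange K`.**
[cite: Cassels1991LecturesEllipticCurves, §15 Lemma 2] [cite: SerreGaloisCohomology1997, I.§2.4] -/
theorem apply_eq_zero_or_eq_of_oneRootDescentH1_eq_zero [CharZero K] [(W.baseChange K).IsElliptic]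
    (hθ : (W.baseChange K).toAffine.IsTwoTorsionX θ)
    (φ : contOneCocycles (discreteTopRep (absoluteGaloisGroup k) (geomTorsion W 2)))
    (h0 : W.oneRootDescentH1 K hθ (oneCocycleClass _ φ) = 0)
    {g : absoluteGaloisGroup k} (hg : g ∈ galRange (K := k) K) :
    φ.1 g = 0 ∨ φ.1 g = W.geomOneRootOverTorsion hθ := by
  obtain ⟨σ, rfl⟩ := hg
  rw [oneRootDescentH1_apply, resTorsion_oneCocycleClass] at h0
  have hval := (W.baseChange K).apply_eq_zero_or_eq_of_oneRootCharH1_eq_zero hθ _ h0 σ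
  rw [contOneCocycles.pullback_apply] at hval
  change ((torsionBaseChangeMap W K 2 (φ.1 (resGal (K := k) K σ)) : geomTorsion (W.baseChange K) 2) :
      geomPoints (W.baseChange K)) = 0 ∨
    ((torsionBaseChangeMap W K 2 (φ.1 (resGal (K := k) K σ)) : geomTorsion (W.baseChange K) 2) :
      geomPoints (W.baseChange K)) = (W.baseChange K).geomOneRoot hθ at hval
  have key : φ.1 (resGal (K := k) K σ) = 0 ∨ φ.1 (resGal (K := k) K σ) = W.geomOneRootOverTorsion hθ := by
    rcases hval with h | h
    · left
      apply torsionBaseChangeMap_injective W K 2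
      rw [map_zero]
      exact Subtype.ext h
    · right
      apply torsionBaseChangeMap_injective W K 2
      apply Subtype.ext
      exact h.trans (W.torsionBaseChangeMap_geomOneRootOverTorsion hθ).symm
  exact key

/-- **Injectivity of the general `2`-descent map on `H¹(k, E[2])`** (Cassels §15 Lemma 2 lifted from `𝔊/2𝔊` to
`H¹`): for `E/k` with irreducible `2`-division cubic and `K = k(θ) ⊃ k` cubic, the composite
`H¹(k, E[2]) → H¹(K, E_K[2]) → H¹(K, μ₂)` (restriction, then `H¹` of the character of `T_θ`) is injective.
[cite: Cassels1991LecturesEllipticCurves, §15 Lemma 2] [cite: SilvermanAEC2009, Thm. X.1.1 and Prop. X.1.4] -/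
theorem oneRootDescentH1_injective [CharZero K] [(W.baseChange K).IsElliptic]
    (hirr : Irreducible (X ^ 3 + C (W.b₂ / 4) * X ^ 2 + C (W.b₄ / 2) * X + C (W.b₆ / 4) : k[X]))
    (h3 : Module.finrank k K = 3) (hθ : (W.baseChange K).toAffine.IsTwoTorsionX θ) :
    Function.Injective (W.oneRootDescentH1 K hθ) := by
  refine (injective_iff_map_eq_zero _).mpr fun c hc => ?_
  obtain ⟨φ, rfl⟩ := oneCocycleClass_surjective _ c
  -- the Klein structure of `V = E[2](k̄)` around `T = T_θ`
  obtain ⟨T₂', T₃', hm2, hm3, h20, h30, h21, h31, h23, hadd, h22, hall⟩ := W.exists_geomTwoTorsion_eq_over hθ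
  set T : geomTorsion W 2 := W.geomOneRootOverTorsion hθ with hT_def
  set T₂ : geomTorsion W 2 := ⟨T₂', hm2⟩
  set T₃ : geomTorsion W 2 := ⟨T₃', hm3⟩
  have h0T : T ≠ 0 := fun h => W.geomOneRootOver_ne_zero hθ (congrArg Subtype.val h)
  have h02 : T₂ ≠ 0 := fun h => h20 (congrArg Subtype.val h)
  have h03 : T₃ ≠ 0 := fun h => h30 (congrArg Subtype.val h)
  have h12 : T ≠ T₂ := fun h => h21 (congrArg Subtype.val h).symm
  have h13 : T ≠ T₃ := fun h => h31 (congrArg Subtype.val h).symm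
  have h23v : T₂ ≠ T₃ := fun h => h23 (congrArg Subtype.val h)
  have haddv : T + T₂ = T₃ := Subtype.ext hadd
  have hTT : T + T = 0 := by
    apply Subtype.ext
    have := W.geomOneRootOver_mem hθ
    rw [mem_geomTorsion_iff, two_zsmul] at this
    exact this
  have h22v : T₂ + T₂ = 0 := Subtype.ext h22
  have hallv : ∀ v : geomTorsion W 2, v = 0 ∨ v = T ∨ v = T₂ ∨ v = T₃ := by
    intro v
    rcases hall v v.2 with h | h | h | h
    · exact Or.inl (Subtype.ext h)
    · exact Or.inr (Or.inl (Subtype.ext h))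
    · exact Or.inr (Or.inr (Or.inl (Subtype.ext h)))
    · exact Or.inr (Or.inr (Or.inr (Subtype.ext h)))
  have hfix := W.exists_smul_ne_of_irreducible hirr
  -- the cocycle and its values on the stabiliser
  have hcoc : ∀ g h : absoluteGaloisGroup k, φ.1 (g * h) = φ.1 g + g • φ.1 h := fun g h => φ.2 g h
  have hstab : ∀ h : absoluteGaloisGroup k, h • T = T → φ.1 h = 0 ∨ φ.1 h = T := by
    intro h hh
    exact W.apply_eq_zero_or_eq_of_oneRootDescentH1_eq_zero hθ φ hc
      ((W.smul_geomOneRootOverTorsion_eq_iff hirr h3 hθ h).mp hh)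
  obtain ⟨P, hP⟩ := KleinCocycle.exists_eq_smul_sub_of_apply_stabilizer h0T h02 h03 h12 h13 haddv hTT h22v
    hallv hfix φ.1 hcoc hstab
  rw [oneCocycleClass_eq_zero_iff]
  exact ⟨P, fun g => hP g⟩

/-- **Corollary (the `2`-Selmer embedding)**: the `2`-Selmer group `Sel⁽²⁾(E/k) ⊆ H¹(k, E[2])` embeds into
`H¹(K, μ₂) ≃ Kˣ/Kˣ²` under the one-root descent map — distinct Selmer classes have distinct Cassels values.
[cite: Cassels1991LecturesEllipticCurves, §15 (μ on the Selmer group)] -/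
theorem oneRootDescentH1_injOn_selmerGroup [NumberField k] [NumberField K] [CharZero K] [(W.baseChange K).IsElliptic]
    (hirr : Irreducible (X ^ 3 + C (W.b₂ / 4) * X ^ 2 + C (W.b₄ / 2) * X + C (W.b₆ / 4) : k[X]))
    (h3 : Module.finrank k K = 3) (hθ : (W.baseChange K).toAffine.IsTwoTorsionX θ) :
    Set.InjOn (W.oneRootDescentH1 K hθ) (selmerGroup W 2 : Set (galH1Torsion W 2)) :=
  (W.oneRootDescentH1_injective hirr h3 hθ).injOn

end WeierstrassCurve

end
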